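import Summits.ABC.IUTFork.Cor312LicenceTripleUnconditionalSlot
import Summits.ABC.IUTFork.Conditional.WRowUnconditionalCellsSlot
import Summits.ABC.IUTFork.Conditional.AbcOfSGenuineKWildInhabitedRow73
import HarnessLib

/-!
# R-W WINDOW-TABLE «W:INHABITED-BANDS-B» — the abc triple `73 + 2¹³·7⁷·941² = 3¹⁶·103³·127` at the SMALL levels `l = 5, 7, 17, 23`:
# the socket's arithmetic (integer-slot variant), complementing `WRowFrey73AllLevels` (every prime `l ≥ 29`)

PROOF-ONLY file (D-0012; 0 definitions, 0 `Prop` facts; almost pure arithmetic) of the abc-iut cell — D-0079 RESCUE sub-cell R-W «WINDOW Θ-SIDE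
INEQUALITY», W1 ROW DECISIONS seat abc-iut-W-row-2 (gen 2), claim «W:INHABITED-BANDS-B» (abc-iut-plan rulings C-R75 / C-R77 / C-R79: «below 29»).
`WRowFrey73AllLevels` (p488605) decides every prime level `l ≥ 29` with ONE fixed envelope exponent per prime and the floor-free end cells; below
`29` that certificate fails (the tame prime `7`, `v_7 = 7`, `e₀ = 15·l`). This file supplies the arithmetic hypothesis `hcell` of abc-iut-W-row-1's
INTEGER-SLOT socket `WRow.licence_triple_unconditional_slot` (`Cor312LicenceTripleUnconditionalSlot`, p488934: inner radius `max(1, ⌊e/(p−1)⌋)` at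
EVERY odd bad prime, abc-iut-c312-5's slot) at the four levels `l ∈ {5, 7, 17, 23}` with exponents chosen per (level, prime), in the manner of
abc-iut-W-row-1's `WRowReyssatSmallLevels`: the admissible indices are `e = e₀·n`; for `n ≥ n₀` the floor-free base cell at `e₀·n₀` with the slot bounded
below by `r·n` (`WRow.cell_tameslot_of_ends`, p-id of `WRowUnconditionalCellsSlot`) resp. the wild cell (`WRow.cell_wild_of_ends`) — `n₀ = 1` everywhere
except `(l, p) = (17, 7)` (`n₀ = 2`, the level `n = 1`, `e = 255`, by the EXACT cells, `decide`) and `(7, 103)` (`e = 70·n < p − 1 = 102`-scale: the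
cell sits ON THE FLOOR — `⌊X/e⌋ ∈ {−1, 0}` — and is proved for every `n` by `WRow.floor_cell_le`, exponents `A = B = 0`). Desk sweep (session folder
work/small73plan.py): at `l ∈ {11, 13}` (prime `103`) and `l = 19` (prime `7`) NO exponent choice makes even the exact cells hold — those three levels
are the triple's residual on the inhabited side. TAKES NO SIDE on [IUTchIII] Cor. 3.12 or on any author; «inhabited as typed» ≠ «asserted in print».

WHAT IS PROVED (namespace `Summit.ABC.IUTFork.Conditional`), THIS PART (levels 5, 7; the four levels are split over `…CellsA` (5, 7) and
`…CellsB` (17, 23) for the 400-line cap): `WRow.floor_cell_le` (arithmetic), **`WRow.hcell_frey73_small57`** — the slot socket's `hcell` for `(73, 2¹³7⁷941², 3¹⁶103³127)` at `l ∈ {5, 7}`. Consumer: `WRowFrey73SmallLevels.lean` (the licence / hull theorems). HONEST SCOPE: integer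
arithmetic plus the cell's typed containers; nothing here bears on the printed inequality; typed ≠ proved; no abc claim.
[cite: Mochizuki2012, IUTchI Def. 3.1 (b),(c) pp. 61–62, Rmk. 3.1.5 p. 65, Ex. 3.2 (iv) p. 71; IUTchIII Cor. 3.12 Step (xi-f) p. 184; IUTchIV Prop. 1.1 p. 9, Prop. 1.2 (i)(ii) p. 10, Prop. 1.4 (ii) p. 13, Cor. 2.2 (ii) proof (P5) p. 46]
[cite: DupuyHilado2025, §3.3, §3.4, §4.9, §4.12] [claim: Mochizuki2012, status: disputed] for the IUT locutions only.
-/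

noncomputable section

open Set Function Metric NumberField IsDedekindDomain

namespace Summit.ABC.IUTFork.Conditional

open Thm311 Thm311.Real Cor312 Cor312Vol Cor312Prov Literature.IUT.LogThetaLattice Literature.IUT.LogVolume
  Literature.IUT.HodgeTheaters Literature.IUT.LogVolume.Cor22
open Literature.NumberTheory.NumberFields Literature.NumberTheory.GaloisRepresentations.Ultrametric
open Literature.NumberTheory.DiophantineGeometry Literature.NumberTheory.DiophantineGeometry.GenEll

/-! ## A cell that sits on the floor -/

/-- **The exact cell from the position of the floor**: if `X < k·e` (`e > 0`) and `(k − 1)·e + c ≤ P` then `e·⌊X/e⌋ + c ≤ P`. [folklore] -/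
theorem WRow.floor_cell_le {e X c P : ℤ} (he : 0 < e) (k : ℤ) (hX : X < k * e) (h : (k - 1) * e + c ≤ P) : e * (X / e) + c ≤ P := by
  have h1 : X / e < k := (Int.ediv_lt_iff_lt_mul he).mpr hX
  have h2 : X / e ≤ k - 1 := by omega
  nlinarith [mul_le_mul_of_nonneg_left h2 he.le]

/-! ## The arithmetic at the levels `l = 5, 7` -/

/-- **The slot socket's arithmetic hypothesis `hcell` for `(73, 2¹³7⁷941², 3¹⁶103³127)` at `l ∈ {5, 7}`**, exponents per (level, prime)
(`A_3 = 5`; `A_7 = 1, –, 2, 3`; `A_73 = A_127 = A_941 = 0`; `A_103 = 0, 0, 1, 1`), base multiples `n₀ = 1` except `(17, 7)` (`n₀ = 2` + exact cells at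
`n = 1`) and `(7, 103)` (floor position, every `n`). [folklore] -/
theorem WRow.hcell_frey73_small57 {l : ℕ} (hl : l = 5 ∨ l = 7) :
    ∀ p : ℕ, p.Prime → p ∣ 73 * 5973865915867136 * 5973865915867209 → p ≠ 2 → p ≠ l → ∀ e : ℕ, 0 < e → l ∣ e →
      15 * l ∣ e * (73 * 5973865915867136 * 5973865915867209).factorization p → (p ∣ 30 → (p - 1) ∣ e) →
      (p ∣ 5973865915867209 → Odd ((73 * 5973865915867136 * 5973865915867209).factorization p) → 30 * l ∣ e * (73 * 5973865915867136 * 5973865915867209).factorization p) →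
      (∀ k : ℕ, (e : ℤ) ≠ (p : ℤ) ^ k * ((p : ℤ) - 1)) ∧
      ∀ i : ℕ, i < (l - 1) / 2 →
        (e : ℤ) * ((((i + 1 : ℕ) : ℤ) ^ 2 * ((e * (2 * (73 * 5973865915867136 * 5973865915867209).factorization p) / (2 * l) : ℕ) : ℤ) -
            ((i + 1 : ℕ) : ℤ) * (((if p ∣ 30 ∧ ¬ p ∣ (73 * 5973865915867136 * 5973865915867209).factorization p then 2 * e - 1 else e - 1 : ℕ) : ℕ) : ℤ) -
            ((i + 2 : ℕ) : ℤ) * ((((max 1 (e / (p - 1))) : ℕ) : ℤ))) / (e : ℤ)) +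
          ((i + 2 : ℕ) : ℤ) * min ((p : ℤ) ^ (if p = 3 then 5 else if p = 7 then 1 else if p = 103 then 0 else 0) - ((if p = 3 then 5 else if p = 7 then 1 else if p = 103 then 0 else 0 : ℕ) : ℤ) * (e : ℤ))
            ((p : ℤ) ^ (if p = 3 then 6 else if p = 7 then 2 else if p = 103 then (if l = 5 then 1 else 0) else 1) - ((if p = 3 then 6 else if p = 7 then 2 else if p = 103 then (if l = 5 then 1 else 0) else 1 : ℕ) : ℤ) * (e : ℤ)) ≤
        ((e * (2 * (73 * 5973865915867136 * 5973865915867209).factorization p) / (2 * l) : ℕ) : ℤ) := by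
  intro p hp hpabc h2 hpl e he _hle h15 h30 hodd
  rcases hl with rfl | rfl <;> rcases eq_of_prime_dvd_triple_73 hp hpabc with rfl | rfl | rfl | rfl | rfl | rfl | rfl
  · exact absurd rfl h2
  · -- `l = 5`, `p = 3`: `e = 150·n`, `A = 5`
    rw [factorization_triple_73.1] at h15 hodd ⊢
    norm_num at h15
    have hm : 75 ∣ e := Nat.Coprime.dvd_of_dvd_mul_right (by norm_num : Nat.Coprime 75 16) h15
    have hpe : 2 ∣ e := by have := h30 (by norm_num); norm_num at this; exact this
    have he0 : 150 ∣ e := by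
      have := Nat.Coprime.mul_dvd_of_dvd_of_dvd (by norm_num : Nat.Coprime 75 2) hm hpe
      rwa [show (75 : ℕ) * 2 = 150 by norm_num] at this
    obtain ⟨n, rfl⟩ := he0
    have hn : 1 ≤ n := by omega
    refine ⟨WRow.natCast_ne_pow_mul_sub_one (by norm_num : Nat.Prime 5) (by norm_num) (by norm_num) (by norm_num) ⟨30 * n, by ring⟩,
      fun i hi => ?_⟩
    rw [if_pos ⟨by norm_num, by norm_num⟩, max_eq_right (show 1 ≤ 150 * n / (3 - 1) by omega)]
    simp only [ite_true]
    refine WRow.cell_wild_of_ends ((3 : ℕ) : ℤ) 150 (3 - 1) (2 * 16) (2 * 5) 5 6 2 (by norm_num) (by norm_num) (by norm_num) (by norm_num)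
      (by norm_num) (by norm_num) ?_ hi hn
    rintro i (rfl | hi')
    · norm_num
    · obtain rfl : i = 1 := by omega
      norm_num
  · -- `l = 5`, `p = 7`: `e = 75·n`, `A = 1`
    rw [factorization_triple_73.2.1] at h15 hodd ⊢
    norm_num at h15
    obtain ⟨n, rfl⟩ := Nat.Coprime.dvd_of_dvd_mul_right (by norm_num : Nat.Coprime 75 7) h15
    have hn : 1 ≤ n := by omega
    refine ⟨WRow.natCast_ne_pow_mul_sub_one (by norm_num : Nat.Prime 5) (by norm_num) (by norm_num) (by norm_num) ⟨15 * n, by ring⟩,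
      fun i hi => ?_⟩
    rw [if_neg (by norm_num : ¬ ((7 : ℕ) ∣ 30 ∧ ¬ (7 : ℕ) ∣ 7))]
    simp only [show ((7 : ℕ) = 3) = False from eq_false (by decide), ite_true, ite_false]
    refine WRow.cell_tameslot_of_ends ((7 : ℕ) : ℤ) 75 (7 - 1) 12 (2 * 7) (2 * 5) 1 2 2 1 (by norm_num) (by norm_num) (by norm_num)
      (by norm_num) (by norm_num) (by norm_num) le_rfl ?_ hi hn
    rintro i (rfl | hi')
    · norm_num
    · obtain rfl : i = 1 := by omega
      norm_num
  · -- `l = 5`, `p = 73`: `e = 75·n`, `A = 0`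
    rw [factorization_triple_73.2.2.1] at h15 hodd ⊢
    norm_num at h15
    obtain ⟨n, rfl⟩ := h15
    have hn : 1 ≤ n := by omega
    refine ⟨WRow.natCast_ne_pow_mul_sub_one (by norm_num : Nat.Prime 5) (by norm_num) (by norm_num) (by norm_num) ⟨15 * n, by ring⟩,
      fun i hi => ?_⟩
    rw [if_neg (by norm_num : ¬ ((73 : ℕ) ∣ 30 ∧ ¬ (73 : ℕ) ∣ 1))]
    simp only [show ((73 : ℕ) = 3) = False from eq_false (by decide), show ((73 : ℕ) = 7) = False from eq_false (by decide), show ((73 : ℕ) = 103) = False from eq_false (by decide), ite_false]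
    refine WRow.cell_tameslot_of_ends ((73 : ℕ) : ℤ) 75 (73 - 1) 1 (2 * 1) (2 * 5) 0 1 2 1 (by norm_num) (by norm_num) (by norm_num)
      (by norm_num) (by norm_num) (by norm_num) le_rfl ?_ hi hn
    rintro i (rfl | hi')
    · norm_num
    · obtain rfl : i = 1 := by omega
      norm_num
  · -- `l = 5`, `p = 103`: `e = 50·n`, `A = 0`
    rw [factorization_triple_73.2.2.2.1] at h15 hodd ⊢
    have hT := hodd (by norm_num) (by decide)
    norm_num at hT
    rw [show (150 : ℕ) = 50 * 3 by norm_num] at hT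
    obtain ⟨n, rfl⟩ := Nat.dvd_of_mul_dvd_mul_right (by norm_num) hT
    have hn : 1 ≤ n := by omega
    refine ⟨WRow.natCast_ne_pow_mul_sub_one (by norm_num : Nat.Prime 5) (by norm_num) (by norm_num) (by norm_num) ⟨10 * n, by ring⟩,
      fun i hi => ?_⟩
    rw [if_neg (by norm_num : ¬ ((103 : ℕ) ∣ 30 ∧ ¬ (103 : ℕ) ∣ 3))]
    simp only [show ((103 : ℕ) = 3) = False from eq_false (by decide), show ((103 : ℕ) = 7) = False from eq_false (by decide), ite_true, ite_false]
    refine WRow.cell_tameslot_of_ends ((103 : ℕ) : ℤ) 50 (103 - 1) 0 (2 * 3) (2 * 5) 0 1 2 1 (by norm_num) (by norm_num) (by norm_num)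
      (by norm_num) (by norm_num) (by norm_num) le_rfl ?_ hi hn
    rintro i (rfl | hi')
    · norm_num
    · obtain rfl : i = 1 := by omega
      norm_num
  · -- `l = 5`, `p = 127`: `e = 150·n`, `A = 0`
    rw [factorization_triple_73.2.2.2.2.1] at h15 hodd ⊢
    have hT := hodd (by norm_num) (by decide)
    norm_num at hT
    obtain ⟨n, rfl⟩ := hT
    have hn : 1 ≤ n := by omega
    refine ⟨WRow.natCast_ne_pow_mul_sub_one (by norm_num : Nat.Prime 5) (by norm_num) (by norm_num) (by norm_num) ⟨30 * n, by ring⟩,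
      fun i hi => ?_⟩
    rw [if_neg (by norm_num : ¬ ((127 : ℕ) ∣ 30 ∧ ¬ (127 : ℕ) ∣ 1))]
    simp only [show ((127 : ℕ) = 3) = False from eq_false (by decide), show ((127 : ℕ) = 7) = False from eq_false (by decide), show ((127 : ℕ) = 103) = False from eq_false (by decide), ite_false]
    refine WRow.cell_tameslot_of_ends ((127 : ℕ) : ℤ) 150 (127 - 1) 1 (2 * 1) (2 * 5) 0 1 2 1 (by norm_num) (by norm_num) (by norm_num)
      (by norm_num) (by norm_num) (by norm_num) le_rfl ?_ hi hn
    rintro i (rfl | hi')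
    · norm_num
    · obtain rfl : i = 1 := by omega
      norm_num
  · -- `l = 5`, `p = 941`: `e = 75·n`, `A = 0`
    rw [factorization_triple_73.2.2.2.2.2] at h15 hodd ⊢
    norm_num at h15
    obtain ⟨n, rfl⟩ := Nat.Coprime.dvd_of_dvd_mul_right (by norm_num : Nat.Coprime 75 2) h15
    have hn : 1 ≤ n := by omega
    refine ⟨WRow.natCast_ne_pow_mul_sub_one (by norm_num : Nat.Prime 3) (by norm_num) (by norm_num) (by norm_num) ⟨25 * n, by ring⟩,
      fun i hi => ?_⟩
    rw [if_neg (by norm_num : ¬ ((941 : ℕ) ∣ 30 ∧ ¬ (941 : ℕ) ∣ 2))]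
    simp only [show ((941 : ℕ) = 3) = False from eq_false (by decide), show ((941 : ℕ) = 7) = False from eq_false (by decide), show ((941 : ℕ) = 103) = False from eq_false (by decide), ite_false]
    refine WRow.cell_tameslot_of_ends ((941 : ℕ) : ℤ) 75 (941 - 1) 0 (2 * 2) (2 * 5) 0 1 2 1 (by norm_num) (by norm_num) (by norm_num)
      (by norm_num) (by norm_num) (by norm_num) le_rfl ?_ hi hn
    rintro i (rfl | hi')
    · norm_num
    · obtain rfl : i = 1 := by omega
      norm_num
  · exact absurd rfl h2
  · -- `l = 7`, `p = 3`: `e = 210·n`, `A = 5`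
    rw [factorization_triple_73.1] at h15 hodd ⊢
    norm_num at h15
    have hm : 105 ∣ e := Nat.Coprime.dvd_of_dvd_mul_right (by norm_num : Nat.Coprime 105 16) h15
    have hpe : 2 ∣ e := by have := h30 (by norm_num); norm_num at this; exact this
    have he0 : 210 ∣ e := by
      have := Nat.Coprime.mul_dvd_of_dvd_of_dvd (by norm_num : Nat.Coprime 105 2) hm hpe
      rwa [show (105 : ℕ) * 2 = 210 by norm_num] at this
    obtain ⟨n, rfl⟩ := he0
    have hn : 1 ≤ n := by omega
    refine ⟨WRow.natCast_ne_pow_mul_sub_one (by norm_num : Nat.Prime 5) (by norm_num) (by norm_num) (by norm_num) ⟨42 * n, by ring⟩,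
      fun i hi => ?_⟩
    rw [if_pos ⟨by norm_num, by norm_num⟩, max_eq_right (show 1 ≤ 210 * n / (3 - 1) by omega)]
    simp only [ite_true]
    refine WRow.cell_wild_of_ends ((3 : ℕ) : ℤ) 210 (3 - 1) (2 * 16) (2 * 7) 5 6 3 (by norm_num) (by norm_num) (by norm_num) (by norm_num)
      (by norm_num) (by norm_num) ?_ hi hn
    rintro i (rfl | hi')
    · norm_num
    · obtain rfl : i = 2 := by omega
      norm_num
  · exact absurd rfl hpl
  · -- `l = 7`, `p = 73`: `e = 105·n`, `A = 0`
    rw [factorization_triple_73.2.2.1] at h15 hodd ⊢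
    norm_num at h15
    obtain ⟨n, rfl⟩ := h15
    have hn : 1 ≤ n := by omega
    refine ⟨WRow.natCast_ne_pow_mul_sub_one (by norm_num : Nat.Prime 5) (by norm_num) (by norm_num) (by norm_num) ⟨21 * n, by ring⟩,
      fun i hi => ?_⟩
    rw [if_neg (by norm_num : ¬ ((73 : ℕ) ∣ 30 ∧ ¬ (73 : ℕ) ∣ 1))]
    simp only [show ((73 : ℕ) = 3) = False from eq_false (by decide), show ((73 : ℕ) = 7) = False from eq_false (by decide), show ((73 : ℕ) = 103) = False from eq_false (by decide), ite_false]
    refine WRow.cell_tameslot_of_ends ((73 : ℕ) : ℤ) 105 (73 - 1) 1 (2 * 1) (2 * 7) 0 1 3 1 (by norm_num) (by norm_num) (by norm_num)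
      (by norm_num) (by norm_num) (by norm_num) le_rfl ?_ hi hn
    rintro i (rfl | hi')
    · norm_num
    · obtain rfl : i = 2 := by omega
      norm_num
  · -- `l = 7`, `p = 103`: `e = 70·n`, `A = 0`, the cell sits on the floor
    rw [factorization_triple_73.2.2.2.1] at h15 hodd ⊢
    have hT := hodd (by norm_num) (by decide)
    norm_num at hT
    rw [show (210 : ℕ) = 70 * 3 by norm_num] at hT
    obtain ⟨n, rfl⟩ := Nat.dvd_of_mul_dvd_mul_right (by norm_num) hT
    have hn : 1 ≤ n := by omega
    refine ⟨WRow.natCast_ne_pow_mul_sub_one (by norm_num : Nat.Prime 5) (by norm_num) (by norm_num) (by norm_num) ⟨14 * n, by ring⟩,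
      fun i hi => ?_⟩
    rw [if_neg (by norm_num : ¬ ((103 : ℕ) ∣ 30 ∧ ¬ (103 : ℕ) ∣ 3))]
    simp only [show ((103 : ℕ) = 3) = False from eq_false (by decide), show ((103 : ℕ) = 7) = False from eq_false (by decide), show ((7 : ℕ) = 5) = False from eq_false (by decide), ite_true, ite_false]
    simp only [pow_zero, Nat.cast_zero, zero_mul, sub_zero, min_self, mul_one]
    have he' : (0 : ℤ) < ((70 * n : ℕ) : ℤ) := by positivity
    have hρ : (1 : ℤ) ≤ ((max 1 (70 * n / (103 - 1)) : ℕ) : ℤ) := by exact_mod_cast le_max_left _ _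
    have hρ' : ((max 1 (70 * n / (103 - 1)) : ℕ) : ℤ) ≤ (n : ℤ) := by
      have : max 1 (70 * n / (103 - 1)) ≤ n := max_le hn (by omega)
      exact_mod_cast this
    generalize ((max 1 (70 * n / (103 - 1)) : ℕ) : ℤ) = ρ at hρ hρ' ⊢
    have hP : (70 * n * (2 * 3) / (2 * 7) : ℕ) = 30 * n := by omega
    have hD : ((70 * n - 1 : ℕ) : ℤ) = 70 * (n : ℤ) - 1 := by rw [Nat.cast_sub (by omega)]; push_cast; ring
    rw [hP, hD]
    have hn' : (1 : ℤ) ≤ n := by exact_mod_cast hn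
    norm_num at hi
    interval_cases i
    · refine WRow.floor_cell_le he' 0 ?_ ?_ <;> push_cast <;> nlinarith
    · refine WRow.floor_cell_le he' 0 ?_ ?_ <;> push_cast <;> nlinarith
    · refine WRow.floor_cell_le he' 1 ?_ ?_ <;> push_cast <;> nlinarith
  · -- `l = 7`, `p = 127`: `e = 210·n`, `A = 0`
    rw [factorization_triple_73.2.2.2.2.1] at h15 hodd ⊢
    have hT := hodd (by norm_num) (by decide)
    norm_num at hT
    obtain ⟨n, rfl⟩ := hT
    have hn : 1 ≤ n := by omega
    refine ⟨WRow.natCast_ne_pow_mul_sub_one (by norm_num : Nat.Prime 5) (by norm_num) (by norm_num) (by norm_num) ⟨42 * n, by ring⟩,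
      fun i hi => ?_⟩
    rw [if_neg (by norm_num : ¬ ((127 : ℕ) ∣ 30 ∧ ¬ (127 : ℕ) ∣ 1))]
    simp only [show ((127 : ℕ) = 3) = False from eq_false (by decide), show ((127 : ℕ) = 7) = False from eq_false (by decide), show ((127 : ℕ) = 103) = False from eq_false (by decide), ite_false]
    refine WRow.cell_tameslot_of_ends ((127 : ℕ) : ℤ) 210 (127 - 1) 1 (2 * 1) (2 * 7) 0 1 3 1 (by norm_num) (by norm_num) (by norm_num)
      (by norm_num) (by norm_num) (by norm_num) le_rfl ?_ hi hn
    rintro i (rfl | hi')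
    · norm_num
    · obtain rfl : i = 2 := by omega
      norm_num
  · -- `l = 7`, `p = 941`: `e = 105·n`, `A = 0`
    rw [factorization_triple_73.2.2.2.2.2] at h15 hodd ⊢
    norm_num at h15
    obtain ⟨n, rfl⟩ := Nat.Coprime.dvd_of_dvd_mul_right (by norm_num : Nat.Coprime 105 2) h15
    have hn : 1 ≤ n := by omega
    refine ⟨WRow.natCast_ne_pow_mul_sub_one (by norm_num : Nat.Prime 3) (by norm_num) (by norm_num) (by norm_num) ⟨35 * n, by ring⟩,
      fun i hi => ?_⟩
    rw [if_neg (by norm_num : ¬ ((941 : ℕ) ∣ 30 ∧ ¬ (941 : ℕ) ∣ 2))]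
    simp only [show ((941 : ℕ) = 3) = False from eq_false (by decide), show ((941 : ℕ) = 7) = False from eq_false (by decide), show ((941 : ℕ) = 103) = False from eq_false (by decide), ite_false]
    refine WRow.cell_tameslot_of_ends ((941 : ℕ) : ℤ) 105 (941 - 1) 0 (2 * 2) (2 * 7) 0 1 3 1 (by norm_num) (by norm_num) (by norm_num)
      (by norm_num) (by norm_num) (by norm_num) le_rfl ?_ hi hn
    rintro i (rfl | hi')
    · norm_num
    · obtain rfl : i = 2 := by omega
      norm_num

end Summit.ABC.IUTFork.Conditional

end
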